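import Summits.AtomisticToContinuum.HydrodynamicLimit.Theorems.JParityClosureLocalSecondLawThermalHeatFluxBounds
import Summits.AtomisticToContinuum.HydrodynamicLimit.Theorems.JParityClosureLocalSecondLawRegularRangeTools

/-!
# Deterministic strain bounds at rate `1/r` from coarse bounds at the doubled radius
(stmt-AtomisticToContinuum-13081, line `exact-entropy-ledger-three-passivities`; deterministic core behind the typed inputs
`StrainTightness` / `ThermalStrainTightness` of `passivityKinetic_of_isotropy` / `passivityThermal_of_closure`;
continued in `…StrainOfCoarseBounds.lean`, the crux-frame reductions)

Under the caps `ρ_{2r} ≤ D`, `e_{2r} ≤ E` on `𝕋³` at the DOUBLED radius and the floor `c ≤ ρ_r` of `Regular`: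
`r |∂ₖ u_{r,l}| ≤ K = 32(D + 2E)(1/c + 8D/c²)` and `r |∂ₖ θ_r| ≤ K' = (2/3)(64E/c + 512DE/c² + K(4D + 8E)/c)` at EVERY
point (junk branch of the crux's `pD` included), for every `r > 0` (on `Regular` alone only `O((1 + ke) r^{-6})` holds,
`abs_pD_uC_le_of_floor`).  The heart is a two-radii inequality for the cone kernel `b_r(y,x) = 3/(πr³)(1 − d(y,x)/r)₊`:
`b_r ≤ 8 b_{2r}` and, for ALL `x, x'`, `|b_r(y,x) − b_r(y,x')| ≤ (32/r)(b_{2r}(y,x) + b_{2r}(y,x')) d(x,x')` (for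
`d(x,x') ≤ r/2` either `d(y,x) ≥ 3r/2` and both kernels vanish, or `b_{2r}(y,x) ≥ (1/32)·3/(πr³)` pays for the Lipschitz
constant `3/(πr⁴)` of `b_r`; for `d(x,x') > r/2` domination suffices).  Summing over particles (`‖v‖ ≤ ½ + ‖v‖²/2`),
`ρ_r`, `m_r`, `e_r` are Lipschitz in the field point with constants `64D/r`, `32(D+2E)/r`, `64E/r` and `‖m_r‖ ≤ 4D + 8E`,
`e_r ≤ 8E`; quotient estimates give the Lipschitz constants `K/r`, `K'/r` of `u_r = m_r/ρ_r` and
`θ_r = (2/3)(e_r/ρ_r − ‖u_r‖²/2)`, and `abs_pD_le_of_lipschitz` bounds the crux's `pD`.  Registered sub-goals (signatures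
verbatim): `strainBound_of_coarseBounds`, `thermalStrainBound_of_coarseBounds`; other names carry the prefix `scb_`.
References: H. Spohn, *Large Scale Dynamics of Interacting Particles* (1991), Part I §3 (coarse-grained empirical
fields); L. C. Evans, R. F. Gariepy, *Measure Theory and Fine Properties of Functions* (1992), §3.1 (`|f′| ≤ Lip f`).
-/

noncomputable section

namespace Summit.AtomisticToContinuum.HydrodynamicLimit.Theorems.LocalSecondLawLedger

open scoped BigOperators Topology Classical MeasureTheory ENNReal InnerProductSpace
open Filter Set MeasureTheory
open Literature.MathematicalPhysics.KineticTheory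
open Literature.Analysis.FluidPDE
open Summit.AtomisticToContinuum.HydrodynamicLimit.Theorems.LocalSecondLawNegative

variable {N : ℕ}

/-! ## The cone kernel at two radii -/

/-- Peak values: `3/(π(2r)³) = (3/(πr³))/8`. -/
theorem scb_peak_two_mul (r : ℝ) : 3 / (Real.pi * (2 * r) ^ 3) = 3 / (Real.pi * r ^ 3) / 8 := by ring

/-- **Domination** `b_r ≤ 8 b_{2r}` (pointwise, `0 < r`). -/
theorem scb_cone_le_cone_two_mul {r : ℝ} (hr : 0 < r) (y x : T3) :
    cone r y x ≤ 8 * cone (2 * r) y x := by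
  unfold cone
  rw [scb_peak_two_mul, show 8 * (3 / (Real.pi * r ^ 3) / 8 * max (1 - Torus.euclidDist y x / (2 * r)) 0) =
    3 / (Real.pi * r ^ 3) * max (1 - Torus.euclidDist y x / (2 * r)) 0 by ring]
  refine mul_le_mul_of_nonneg_left (max_le_max ?_ le_rfl) (by positivity)
  have : Torus.euclidDist y x / (2 * r) ≤ Torus.euclidDist y x / r :=
    div_le_div_of_nonneg_left (norm_nonneg _) hr (by linarith)
  linarith

/-- On the ball of radius `3r/2` the doubled kernel is at least `(1/32)·3/(πr³)`. -/
theorem scb_cone_two_mul_ge {r : ℝ} (hr : 0 < r) {y x : T3} (h : Torus.euclidDist y x ≤ 3 / 2 * r) :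
    3 / (Real.pi * r ^ 3) / 32 ≤ cone (2 * r) y x := by
  unfold cone
  rw [scb_peak_two_mul]
  have h1 : 1 / 4 ≤ max (1 - Torus.euclidDist y x / (2 * r)) 0 := by
    refine le_trans ?_ (le_max_left _ _)
    have : Torus.euclidDist y x / (2 * r) ≤ 3 / 4 := by
      rw [div_le_iff₀ (by positivity)]; linarith
    linarith
  calc 3 / (Real.pi * r ^ 3) / 32 = 3 / (Real.pi * r ^ 3) / 8 * (1 / 4) := by ring
    _ ≤ _ := mul_le_mul_of_nonneg_left h1 (by positivity)

/-- **Two-radii Lipschitz inequality of the cone kernel**: for all `x, x'`,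
`|b_r(y,x) − b_r(y,x')| ≤ (32/r) (b_{2r}(y,x) + b_{2r}(y,x')) d(x,x')`. -/
theorem scb_abs_cone_sub_cone_le_two_mul {r : ℝ} (hr : 0 < r) (y x x' : T3) :
    |cone r y x - cone r y x'| ≤
      32 / r * (cone (2 * r) y x + cone (2 * r) y x') * Torus.euclidDist x x' := by
  have hd0 : 0 ≤ Torus.euclidDist x x' := norm_nonneg _
  have hr2 : 0 < 2 * r := by positivity
  have hb0 : 0 ≤ cone (2 * r) y x := cone_nonneg hr2 _ _
  have hb0' : 0 ≤ cone (2 * r) y x' := cone_nonneg hr2 _ _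
  by_cases hdr : Torus.euclidDist x x' ≤ r / 2
  · by_cases ha : 3 / 2 * r ≤ Torus.euclidDist y x
    · have htri := euclidDist_triangle y x' x -- both kernels vanish (`densMod_cone_eq_zero`: same kernel, defeq)
      rw [Torus.euclidDist_comm x' x] at htri
      have h0 : cone r y x = 0 := densMod_cone_eq_zero hr (le_trans (by linarith) ha)
      have h0' : cone r y x' = 0 := densMod_cone_eq_zero hr (show r ≤ Torus.euclidDist y x' by linarith)
      rw [h0, h0', sub_zero, abs_zero]
      positivity
    · push Not at ha
      have hfl := scb_cone_two_mul_ge hr ha.le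
      have hkey : 3 / (Real.pi * r ^ 4) ≤ 32 / r * (cone (2 * r) y x + cone (2 * r) y x') := by
        calc 3 / (Real.pi * r ^ 4) = 32 / r * (3 / (Real.pi * r ^ 3) / 32 + 0) := by field_simp; ring
          _ ≤ 32 / r * (cone (2 * r) y x + cone (2 * r) y x') := by gcongr
      exact (rr_abs_cone_sub_cone_centre hr y x x').trans (mul_le_mul_of_nonneg_right hkey hd0)
  · push Not at hdr
    calc |cone r y x - cone r y x'| ≤ |cone r y x| + |cone r y x'| := abs_sub _ _
      _ = cone r y x + cone r y x' := by
          rw [abs_of_nonneg (cone_nonneg hr _ _), abs_of_nonneg (cone_nonneg hr _ _)]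
      _ ≤ 8 * cone (2 * r) y x + 8 * cone (2 * r) y x' :=
          add_le_add (scb_cone_le_cone_two_mul hr y x) (scb_cone_le_cone_two_mul hr y x')
      _ = 32 / r * (cone (2 * r) y x + cone (2 * r) y x') * (r / 4) := by field_simp; ring
      _ ≤ 32 / r * (cone (2 * r) y x + cone (2 * r) y x') * Torus.euclidDist x x' := by
          refine mul_le_mul_of_nonneg_left (by linarith) (by positivity)

/-! ## The coarse fields at two radii: domination and Lipschitz bounds -/

/-- `e_r ≤ 8 e_{2r}`. -/
theorem scb_kinC_le_two_mul {r : ℝ} (hr : 0 < r) (w : Phase N) (x : T3) :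
    kinC r w x ≤ 8 * kinC (2 * r) w x := by
  rw [kinC_eq_sum, kinC_eq_sum, mul_left_comm]
  refine mul_le_mul_of_nonneg_left ?_ (by positivity)
  rw [Finset.mul_sum]
  refine Finset.sum_le_sum fun i _ => ?_
  rw [← mul_assoc]
  exact mul_le_mul_of_nonneg_right (scb_cone_le_cone_two_mul hr _ _) (by positivity)

/-- `‖m_r‖ ≤ 4 ρ_{2r} + 8 e_{2r}`. -/
theorem scb_norm_momC_le {r : ℝ} (hr : 0 < r) (w : Phase N) (x : T3) :
    ‖momC r w x‖ ≤ 4 * rhoC (2 * r) w x + 8 * kinC (2 * r) w x := by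
  have hr2 : 0 < 2 * r := by positivity
  rw [psvK_momC_eq_sum, psvK_rhoC_eq_sum, kinC_eq_sum, norm_smul, Real.norm_eq_abs,
    abs_of_nonneg (by positivity : (0:ℝ) ≤ ((N + 1 : ℕ) : ℝ)⁻¹)]
  have hterm : ∀ i : Fin (N + 1), ‖cone r (w i).1 x • (w i).2‖ ≤
      4 * cone (2 * r) (w i).1 x + 8 * (cone (2 * r) (w i).1 x * (‖(w i).2‖ ^ 2 / 2)) := by
    intro i
    rw [norm_smul, Real.norm_eq_abs, abs_of_nonneg (cone_nonneg hr _ _)]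
    have h2 : ‖(w i).2‖ ≤ 1 / 2 + ‖(w i).2‖ ^ 2 / 2 := by
      nlinarith [sq_nonneg (‖(w i).2‖ - 1), norm_nonneg (w i).2]
    have h3 := cone_nonneg hr2 (w i).1 x
    calc cone r (w i).1 x * ‖(w i).2‖ ≤ 8 * cone (2 * r) (w i).1 x * (1 / 2 + ‖(w i).2‖ ^ 2 / 2) :=
          mul_le_mul (scb_cone_le_cone_two_mul hr (w i).1 x) h2 (norm_nonneg _) (by positivity)
      _ = _ := by ring
  calc ((N + 1 : ℕ) : ℝ)⁻¹ * ‖∑ i, cone r (w i).1 x • (w i).2‖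
      ≤ ((N + 1 : ℕ) : ℝ)⁻¹ * ∑ i, (4 * cone (2 * r) (w i).1 x + 8 * (cone (2 * r) (w i).1 x * (‖(w i).2‖ ^ 2 / 2))) := by
        gcongr
        exact (norm_sum_le _ _).trans (Finset.sum_le_sum fun i _ => hterm i)
    _ = _ := by
        rw [Finset.sum_add_distrib, ← Finset.mul_sum, ← Finset.mul_sum]; ring

/-- `ρ_r` is Lipschitz in the field point at the two-radii rate: `|ρ_r(x) − ρ_r(x')| ≤ (32/r)(ρ_{2r}(x) + ρ_{2r}(x')) d(x,x')`. -/
theorem scb_abs_rhoC_sub_le {r : ℝ} (hr : 0 < r) (w : Phase N) (x x' : T3) :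
    |rhoC r w x - rhoC r w x'| ≤
      32 / r * (rhoC (2 * r) w x + rhoC (2 * r) w x') * Torus.euclidDist x x' := by
  simp only [psvK_rhoC_eq_sum]
  rw [← mul_sub, ← Finset.sum_sub_distrib, abs_mul, abs_of_nonneg (by positivity : (0:ℝ) ≤ ((N + 1 : ℕ) : ℝ)⁻¹)]
  calc ((N + 1 : ℕ) : ℝ)⁻¹ * |∑ i, (cone r (w i).1 x - cone r (w i).1 x')|
      ≤ ((N + 1 : ℕ) : ℝ)⁻¹ * ∑ i, 32 / r * (cone (2 * r) (w i).1 x + cone (2 * r) (w i).1 x') *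
          Torus.euclidDist x x' := by
        gcongr
        exact (Finset.abs_sum_le_sum_abs _ _).trans
          (Finset.sum_le_sum fun i _ => scb_abs_cone_sub_cone_le_two_mul hr _ _ _)
    _ = _ := by
        rw [← Finset.sum_mul, ← Finset.mul_sum, Finset.sum_add_distrib]; ring

/-- `e_r` is Lipschitz in the field point at the two-radii rate: `|e_r(x) − e_r(x')| ≤ (32/r)(e_{2r}(x) + e_{2r}(x')) d(x,x')`. -/
theorem scb_abs_kinC_sub_le {r : ℝ} (hr : 0 < r) (w : Phase N) (x x' : T3) :
    |kinC r w x - kinC r w x'| ≤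
      32 / r * (kinC (2 * r) w x + kinC (2 * r) w x') * Torus.euclidDist x x' := by
  simp only [kinC_eq_sum]
  rw [← mul_sub, ← Finset.sum_sub_distrib, abs_mul, abs_of_nonneg (by positivity : (0:ℝ) ≤ ((N + 1 : ℕ) : ℝ)⁻¹)]
  calc ((N + 1 : ℕ) : ℝ)⁻¹ *
        |∑ i, (cone r (w i).1 x * (‖(w i).2‖ ^ 2 / 2) - cone r (w i).1 x' * (‖(w i).2‖ ^ 2 / 2))|
      ≤ ((N + 1 : ℕ) : ℝ)⁻¹ * ∑ i, 32 / r * (cone (2 * r) (w i).1 x * (‖(w i).2‖ ^ 2 / 2) +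
          cone (2 * r) (w i).1 x' * (‖(w i).2‖ ^ 2 / 2)) * Torus.euclidDist x x' := by
        gcongr
        refine (Finset.abs_sum_le_sum_abs _ _).trans (Finset.sum_le_sum fun i _ => ?_)
        rw [← sub_mul, abs_mul, abs_of_nonneg (by positivity : (0:ℝ) ≤ ‖(w i).2‖ ^ 2 / 2)]
        calc |cone r (w i).1 x - cone r (w i).1 x'| * (‖(w i).2‖ ^ 2 / 2)
            ≤ 32 / r * (cone (2 * r) (w i).1 x + cone (2 * r) (w i).1 x') * Torus.euclidDist x x' *
                (‖(w i).2‖ ^ 2 / 2) :=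
              mul_le_mul_of_nonneg_right (scb_abs_cone_sub_cone_le_two_mul hr _ _ _) (by positivity)
          _ = _ := by ring
    _ = _ := by
        rw [← Finset.sum_mul, ← Finset.mul_sum, Finset.sum_add_distrib]; ring

/-- `m_r` is Lipschitz in the field point at the two-radii rate:
`‖m_r(x) − m_r(x')‖ ≤ (32/r)((ρ_{2r}(x) + ρ_{2r}(x'))/2 + e_{2r}(x) + e_{2r}(x')) d(x,x')`. -/
theorem scb_norm_momC_sub_le {r : ℝ} (hr : 0 < r) (w : Phase N) (x x' : T3) :
    ‖momC r w x - momC r w x'‖ ≤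
      32 / r * ((rhoC (2 * r) w x + rhoC (2 * r) w x') / 2 + (kinC (2 * r) w x + kinC (2 * r) w x')) *
        Torus.euclidDist x x' := by
  have hr2 : 0 < 2 * r := by positivity
  have hd : 0 ≤ Torus.euclidDist x x' := norm_nonneg _
  rw [psvK_momC_eq_sum, psvK_momC_eq_sum, ← smul_sub, ← Finset.sum_sub_distrib, norm_smul, Real.norm_eq_abs,
    abs_of_nonneg (by positivity : (0:ℝ) ≤ ((N + 1 : ℕ) : ℝ)⁻¹)]
  simp only [psvK_rhoC_eq_sum, kinC_eq_sum]
  have hterm : ∀ i : Fin (N + 1), ‖cone r (w i).1 x • (w i).2 - cone r (w i).1 x' • (w i).2‖ ≤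
      32 / r * Torus.euclidDist x x' * ((cone (2 * r) (w i).1 x + cone (2 * r) (w i).1 x') / 2) +
        32 / r * Torus.euclidDist x x' *
          (cone (2 * r) (w i).1 x * (‖(w i).2‖ ^ 2 / 2) + cone (2 * r) (w i).1 x' * (‖(w i).2‖ ^ 2 / 2)) := by
    intro i
    rw [← sub_smul, norm_smul, Real.norm_eq_abs]
    have h2 : ‖(w i).2‖ ≤ 1 / 2 + ‖(w i).2‖ ^ 2 / 2 := by
      nlinarith [sq_nonneg (‖(w i).2‖ - 1), norm_nonneg (w i).2]
    have hS : 0 ≤ cone (2 * r) (w i).1 x + cone (2 * r) (w i).1 x' :=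
      add_nonneg (cone_nonneg hr2 _ _) (cone_nonneg hr2 _ _)
    calc |cone r (w i).1 x - cone r (w i).1 x'| * ‖(w i).2‖
        ≤ 32 / r * (cone (2 * r) (w i).1 x + cone (2 * r) (w i).1 x') * Torus.euclidDist x x' *
            (1 / 2 + ‖(w i).2‖ ^ 2 / 2) :=
          mul_le_mul (scb_abs_cone_sub_cone_le_two_mul hr (w i).1 x x') h2 (norm_nonneg _) (by positivity)
      _ = _ := by ring
  calc ((N + 1 : ℕ) : ℝ)⁻¹ * ‖∑ i, (cone r (w i).1 x • (w i).2 - cone r (w i).1 x' • (w i).2)‖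
      ≤ ((N + 1 : ℕ) : ℝ)⁻¹ * ∑ i,
          (32 / r * Torus.euclidDist x x' * ((cone (2 * r) (w i).1 x + cone (2 * r) (w i).1 x') / 2) +
            32 / r * Torus.euclidDist x x' *
              (cone (2 * r) (w i).1 x * (‖(w i).2‖ ^ 2 / 2) + cone (2 * r) (w i).1 x' * (‖(w i).2‖ ^ 2 / 2))) := by
        gcongr
        exact (norm_sum_le _ _).trans (Finset.sum_le_sum fun i _ => hterm i)
    _ = _ := by
        rw [Finset.sum_add_distrib, ← Finset.mul_sum, ← Finset.mul_sum, ← Finset.sum_div, Finset.sum_add_distrib,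
          Finset.sum_add_distrib]
        ring

/-! ## Quotient estimates; the fields under the caps `ρ_{2r} ≤ D`, `e_{2r} ≤ E` and the floor `c ≤ ρ_r` -/

/-- Vector quotient estimate: `‖M/R − M₀/R₀‖ ≤ A/c + Mb·B/c²` from `‖M − M₀‖ ≤ A`, `|R − R₀| ≤ B`, `‖M₀‖ ≤ Mb` and the
floor `c ≤ R, R₀` (`0 < c`). -/
theorem scb_norm_smul_sub_smul_le {M M₀ : V3} {R R₀ A B Mb c : ℝ} (hc : 0 < c) (hR : c ≤ R) (hR₀ : c ≤ R₀)
    (hM : ‖M - M₀‖ ≤ A) (hRR : |R - R₀| ≤ B) (hMb : ‖M₀‖ ≤ Mb) :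
    ‖R⁻¹ • M - R₀⁻¹ • M₀‖ ≤ A / c + Mb * B / c ^ 2 := by
  have hRpos : 0 < R := hc.trans_le hR
  have hR₀pos : 0 < R₀ := hc.trans_le hR₀
  have hA : 0 ≤ A := (norm_nonneg _).trans hM
  have hB : 0 ≤ B := (abs_nonneg _).trans hRR
  have hMb0 : 0 ≤ Mb := (norm_nonneg _).trans hMb
  have hsplit : R⁻¹ • M - R₀⁻¹ • M₀ = R⁻¹ • (M - M₀) + (R⁻¹ - R₀⁻¹) • M₀ := by
    rw [smul_sub, sub_smul]; abel
  rw [hsplit]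
  refine (norm_add_le _ _).trans (add_le_add ?_ ?_)
  · rw [norm_smul, Real.norm_eq_abs, abs_of_pos (inv_pos.2 hRpos)]
    calc R⁻¹ * ‖M - M₀‖ ≤ c⁻¹ * A :=
          mul_le_mul ((inv_le_inv₀ hRpos hc).2 hR) hM (norm_nonneg _) (inv_nonneg.2 hc.le)
      _ = A / c := by rw [div_eq_inv_mul]
  · rw [norm_smul, Real.norm_eq_abs, inv_sub_inv hRpos.ne' hR₀pos.ne', abs_div, abs_of_pos (mul_pos hRpos hR₀pos),
      abs_sub_comm]
    calc |R - R₀| / (R * R₀) * ‖M₀‖ ≤ B / c ^ 2 * Mb := by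
          refine mul_le_mul ?_ hMb (norm_nonneg _) (by positivity)
          calc |R - R₀| / (R * R₀) ≤ B / (R * R₀) := div_le_div_of_nonneg_right hRR (by positivity)
            _ ≤ B / c ^ 2 := div_le_div_of_nonneg_left hB (by positivity)
                (by rw [sq]; exact mul_le_mul hR hR₀ hc.le hRpos.le)
      _ = Mb * B / c ^ 2 := by ring

/-- Scalar estimate behind the temperature: with floors `c ≤ R, R'`, `0 ≤ K' ≤ Kb`, `|K − K'| ≤ A`, `|R − R'| ≤ B`,
`|a − a'| ≤ C`, `0 ≤ a, a' ≤ U`:  `|(K/R − a²/2) − (K'/R' − a'²/2)| ≤ A/c + Kb·B/c² + C·U`. -/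
theorem scb_abs_thermal_sub_le {K K' R R' a a' A B C U Kb c : ℝ} (hc : 0 < c) (hR : c ≤ R) (hR' : c ≤ R')
    (hK'0 : 0 ≤ K') (hK'b : K' ≤ Kb) (hKK : |K - K'| ≤ A) (hRR : |R - R'| ≤ B) (haa : |a - a'| ≤ C)
    (ha0 : 0 ≤ a) (haU : a ≤ U) (ha0' : 0 ≤ a') (haU' : a' ≤ U) :
    |(K / R - a ^ 2 / 2) - (K' / R' - a' ^ 2 / 2)| ≤ A / c + Kb * B / c ^ 2 + C * U := by
  have hRpos : 0 < R := hc.trans_le hR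
  have hR'pos : 0 < R' := hc.trans_le hR'
  have hA : 0 ≤ A := (abs_nonneg _).trans hKK
  have hB : 0 ≤ B := (abs_nonneg _).trans hRR
  have hC : 0 ≤ C := (abs_nonneg _).trans haa
  have hKb : 0 ≤ Kb := hK'0.trans hK'b
  have hsplit : (K / R - a ^ 2 / 2) - (K' / R' - a' ^ 2 / 2) =
      (K - K') / R + K' * (R' - R) / (R * R') - (a - a') * ((a + a') / 2) := by
    field_simp; ring
  rw [hsplit]
  have h1 : |(K - K') / R| ≤ A / c := by
    rw [abs_div, abs_of_pos hRpos]
    exact (div_le_div_of_nonneg_right hKK hRpos.le).trans (div_le_div_of_nonneg_left hA hc hR)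
  have h2 : |K' * (R' - R) / (R * R')| ≤ Kb * B / c ^ 2 := by
    rw [abs_div, abs_mul, abs_of_nonneg hK'0, abs_of_pos (mul_pos hRpos hR'pos), abs_sub_comm]
    have hnum : K' * |R - R'| ≤ Kb * B := mul_le_mul hK'b hRR (abs_nonneg _) hKb
    have hden : c ^ 2 ≤ R * R' := by rw [sq]; exact mul_le_mul hR hR' hc.le hRpos.le
    exact (div_le_div_of_nonneg_right hnum (mul_pos hRpos hR'pos).le).trans
      (div_le_div_of_nonneg_left (mul_nonneg hKb hB) (by positivity) hden)
  have h3 : |(a - a') * ((a + a') / 2)| ≤ C * U := by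
    rw [abs_mul, abs_of_nonneg (by linarith : (0:ℝ) ≤ (a + a') / 2)]
    exact mul_le_mul haa (by linarith) (by linarith) hC
  calc |(K - K') / R + K' * (R' - R) / (R * R') - (a - a') * ((a + a') / 2)|
      ≤ |(K - K') / R + K' * (R' - R) / (R * R')| + |(a - a') * ((a + a') / 2)| := abs_sub _ _
    _ ≤ _ := by linarith [abs_add_le ((K - K') / R) (K' * (R' - R) / (R * R'))]

/-- `|ρ_r(x) − ρ_r(x')| ≤ (64D/r) d(x,x')`. -/
theorem scb_abs_rhoC_sub_le_caps {r D : ℝ} (hr : 0 < r) {w : Phase N} (hD : ∀ y, rhoC (2 * r) w y ≤ D)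
    (x x' : T3) : |rhoC r w x - rhoC r w x'| ≤ 64 * D / r * Torus.euclidDist x x' := by
  refine (scb_abs_rhoC_sub_le hr w x x').trans (le_of_le_of_eq (mul_le_mul_of_nonneg_right
    (mul_le_mul_of_nonneg_left (add_le_add (hD x) (hD x')) (by positivity)) (norm_nonneg _)) (by ring))

/-- `|e_r(x) − e_r(x')| ≤ (64E/r) d(x,x')`. -/
theorem scb_abs_kinC_sub_le_caps {r E : ℝ} (hr : 0 < r) {w : Phase N} (hE : ∀ y, kinC (2 * r) w y ≤ E)
    (x x' : T3) : |kinC r w x - kinC r w x'| ≤ 64 * E / r * Torus.euclidDist x x' := by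
  refine (scb_abs_kinC_sub_le hr w x x').trans (le_of_le_of_eq (mul_le_mul_of_nonneg_right
    (mul_le_mul_of_nonneg_left (add_le_add (hE x) (hE x')) (by positivity)) (norm_nonneg _)) (by ring))

/-- `‖m_r(x) − m_r(x')‖ ≤ (32(D + 2E)/r) d(x,x')`. -/
theorem scb_norm_momC_sub_le_caps {r D E : ℝ} (hr : 0 < r) {w : Phase N} (hD : ∀ y, rhoC (2 * r) w y ≤ D)
    (hE : ∀ y, kinC (2 * r) w y ≤ E) (x x' : T3) :
    ‖momC r w x - momC r w x'‖ ≤ 32 * (D + 2 * E) / r * Torus.euclidDist x x' := by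
  refine (scb_norm_momC_sub_le hr w x x').trans (le_of_le_of_eq (mul_le_mul_of_nonneg_right
    (mul_le_mul_of_nonneg_left (?_ : _ ≤ (D + D) / 2 + (E + E)) (by positivity)) (norm_nonneg _)) (by ring))
  linarith [hD x, hD x', hE x, hE x']

/-- On the floor: `‖u_r‖ ≤ (4D + 8E)/c`. -/
theorem scb_norm_uC_le_caps {r c D E : ℝ} (hr : 0 < r) (hc : 0 < c) {w : Phase N} (hfl : ∀ y, c ≤ rhoC r w y)
    (hD : ∀ y, rhoC (2 * r) w y ≤ D) (hE : ∀ y, kinC (2 * r) w y ≤ E) (x : T3) :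
    ‖uC r w x‖ ≤ (4 * D + 8 * E) / c := by
  have hρ : 0 < rhoC r w x := hc.trans_le (hfl x)
  unfold uC
  rw [norm_smul, Real.norm_eq_abs, abs_of_pos (inv_pos.2 hρ), le_div_iff₀ hc]
  calc (rhoC r w x)⁻¹ * ‖momC r w x‖ * c ≤ (rhoC r w x)⁻¹ * ‖momC r w x‖ * rhoC r w x :=
        mul_le_mul_of_nonneg_left (hfl x) (by positivity)
    _ = ‖momC r w x‖ := by field_simp
    _ ≤ 4 * D + 8 * E := by linarith [scb_norm_momC_le hr w x, hD x, hE x]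

/-- **The coarse velocity is `K(c,D,E)/r`-Lipschitz in the field point** on the floor under the caps,
`K = 32(D + 2E)(1/c + 8D/c²)`. -/
theorem scb_norm_uC_sub_le_caps {r c D E : ℝ} (hr : 0 < r) (hc : 0 < c) {w : Phase N} (hfl : ∀ y, c ≤ rhoC r w y)
    (hD : ∀ y, rhoC (2 * r) w y ≤ D) (hE : ∀ y, kinC (2 * r) w y ≤ E) (x x' : T3) :
    ‖uC r w x - uC r w x'‖ ≤ 32 * (D + 2 * E) * (1 / c + 8 * D / c ^ 2) / r * Torus.euclidDist x x' := by
  have h := scb_norm_smul_sub_smul_le (M := momC r w x) (M₀ := momC r w x') hc (hfl x) (hfl x')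
    (scb_norm_momC_sub_le_caps hr hD hE x x') (scb_abs_rhoC_sub_le_caps hr hD x x')
    (show ‖momC r w x'‖ ≤ 4 * D + 8 * E by linarith [scb_norm_momC_le hr w x', hD x', hE x'])
  have hr' := hr.ne'
  have hc' := hc.ne'
  calc ‖uC r w x - uC r w x'‖ = ‖(rhoC r w x)⁻¹ • momC r w x - (rhoC r w x')⁻¹ • momC r w x'‖ := rfl
    _ ≤ _ := h
    _ = _ := by field_simp; ring

/-- **The coarse temperature is `K'(c,D,E)/r`-Lipschitz in the field point** on the floor under the caps,
`K' = (2/3)(64E/c + 512DE/c² + K (4D+8E)/c)`. -/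
theorem scb_abs_thetaC_sub_le_caps {r c D E : ℝ} (hr : 0 < r) (hc : 0 < c) {w : Phase N}
    (hfl : ∀ y, c ≤ rhoC r w y) (hD : ∀ y, rhoC (2 * r) w y ≤ D) (hE : ∀ y, kinC (2 * r) w y ≤ E) (x x' : T3) :
    |thetaC r w x - thetaC r w x'| ≤
      2 / 3 * (64 * E / c + 8 * E * (64 * D) / c ^ 2 +
        32 * (D + 2 * E) * (1 / c + 8 * D / c ^ 2) * ((4 * D + 8 * E) / c)) / r * Torus.euclidDist x x' := by
  set d := Torus.euclidDist x x' with hd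
  have hRpos : 0 < rhoC r w x := hc.trans_le (hfl x)
  have hR'pos : 0 < rhoC r w x' := hc.trans_le (hfl x')
  have hK'le : kinC r w x' ≤ 8 * E :=
    (scb_kinC_le_two_mul hr w x').trans (by linarith [hE x'])
  have huu : |‖uC r w x‖ - ‖uC r w x'‖| ≤ 32 * (D + 2 * E) * (1 / c + 8 * D / c ^ 2) / r * d :=
    (abs_norm_sub_norm_le _ _).trans (scb_norm_uC_sub_le_caps hr hc hfl hD hE x x')
  have h := scb_abs_thermal_sub_le hc (hfl x) (hfl x') (kinC_nonneg hr w x') hK'le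
    (scb_abs_kinC_sub_le_caps hr hE x x') (scb_abs_rhoC_sub_le_caps hr hD x x') huu (norm_nonneg _)
    (scb_norm_uC_le_caps hr hc hfl hD hE x) (norm_nonneg _) (scb_norm_uC_le_caps hr hc hfl hD hE x')
  rw [psvT_thetaC_eq_uC hRpos.ne', psvT_thetaC_eq_uC hR'pos.ne', ← mul_sub, abs_mul,
    abs_of_pos (by norm_num : (0:ℝ) < 2 / 3)]
  have hr' := hr.ne'
  have hc' := hc.ne'
  calc 2 / 3 * |kinC r w x / rhoC r w x - ‖uC r w x‖ ^ 2 / 2 - (kinC r w x' / rhoC r w x' - ‖uC r w x'‖ ^ 2 / 2)|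
      ≤ 2 / 3 * (64 * E / r * d / c + 8 * E * (64 * D / r * d) / c ^ 2 +
          32 * (D + 2 * E) * (1 / c + 8 * D / c ^ 2) / r * d * ((4 * D + 8 * E) / c)) :=
        mul_le_mul_of_nonneg_left h (by norm_num)
    _ = _ := by ring

/-- **Deterministic strain bound at rate `1/r`** (configuration level): on the floor under the caps,
`r |∂ₖ u_{r,l}(x)| ≤ K(c, D, E)` at every point. -/
theorem scb_mul_abs_pD_uC_le {r c D E : ℝ} (hr : 0 < r) (hc : 0 < c) {w : Phase N} (hfl : ∀ y, c ≤ rhoC r w y)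
    (hD : ∀ y, rhoC (2 * r) w y ≤ D) (hE : ∀ y, kinC (2 * r) w y ≤ E) (x : T3) (k l : Fin 3) :
    r * |pD k (fun y => uC r w y l) x| ≤ 32 * (D + 2 * E) * (1 / c + 8 * D / c ^ 2) := by
  have hr2 : 0 < 2 * r := by positivity
  have hE0 : 0 ≤ E := (kinC_nonneg hr2 w x).trans (hE x)
  have hD0 : 0 ≤ D := (rhoC_nonneg hr2 w x).trans (hD x)
  have hK0 : 0 ≤ 32 * (D + 2 * E) * (1 / c + 8 * D / c ^ 2) / r := by positivity
  have hlip : ∀ y y', |uC r w y l - uC r w y' l| ≤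
      32 * (D + 2 * E) * (1 / c + 8 * D / c ^ 2) / r * Torus.euclidDist y y' := by
    intro y y'
    calc |uC r w y l - uC r w y' l| = |(uC r w y - uC r w y') l| := by rw [PiLp.sub_apply]
      _ ≤ ‖uC r w y - uC r w y'‖ := by rw [← Real.norm_eq_abs]; exact PiLp.norm_apply_le _ _
      _ ≤ _ := scb_norm_uC_sub_le_caps hr hc hfl hD hE y y'
  have h := abs_pD_le_of_lipschitz (f := fun y => uC r w y l) hK0 hlip k x
  rw [le_div_iff₀ hr] at h; linarith

/-- **Deterministic thermal-strain bound at rate `1/r`** (configuration level): on the floor under the caps,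
`r |∂ₖ θ_r(x)| ≤ K'(c, D, E)` at every point. -/
theorem scb_mul_abs_pD_thetaC_le {r c D E : ℝ} (hr : 0 < r) (hc : 0 < c) {w : Phase N}
    (hfl : ∀ y, c ≤ rhoC r w y) (hD : ∀ y, rhoC (2 * r) w y ≤ D) (hE : ∀ y, kinC (2 * r) w y ≤ E)
    (x : T3) (k : Fin 3) :
    r * |pD k (fun y => thetaC r w y) x| ≤
      2 / 3 * (64 * E / c + 8 * E * (64 * D) / c ^ 2 +
        32 * (D + 2 * E) * (1 / c + 8 * D / c ^ 2) * ((4 * D + 8 * E) / c)) := by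
  have hr2 : 0 < 2 * r := by positivity
  have hE0 : 0 ≤ E := (kinC_nonneg hr2 w x).trans (hE x)
  have hD0 : 0 ≤ D := (rhoC_nonneg hr2 w x).trans (hD x)
  have hK0 : 0 ≤ 2 / 3 * (64 * E / c + 8 * E * (64 * D) / c ^ 2 +
      32 * (D + 2 * E) * (1 / c + 8 * D / c ^ 2) * ((4 * D + 8 * E) / c)) / r := by positivity
  have h := abs_pD_le_of_lipschitz (f := fun y => thetaC r w y) hK0
    (fun y y' => scb_abs_thetaC_sub_le_caps hr hc hfl hD hE y y') k x
  rw [le_div_iff₀ hr] at h; linarith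

/-! ## Registered sub-goals (stmt-AtomisticToContinuum-13081; signatures verbatim) -/

/-- Registered sub-goal `strainBound_of_coarseBounds`: along a flow, on `Regular σ r τ c η₁ Φ z` and under the caps
`ρ_{2r} ≤ D`, `e_{2r} ≤ E` on `[0,τ] × 𝕋³`, the resolved strain satisfies `r |∂ₖ u_{r,l}| ≤ K(c, D, E)` on
`[0,τ] × 𝕋³` (deterministic, every `r > 0`). -/
theorem strainBound_of_coarseBounds :
  ∀ {N : ℕ} {σ r τ c η₁ D E : ℝ} {Φ : Flow σ N} {z : Phase N}, 0 < r → 0 < c → Regular σ r τ c η₁ Φ z → (∀ s ∈ Set.Icc (0 : ℝ) τ, ∀ x : T3, rhoC (2 * r) (Φ.flow s z) x ≤ D ∧ kinC (2 * r) (Φ.flow s z) x ≤ E) → ∀ s ∈ Set.Icc (0 : ℝ) τ, ∀ (x : T3) (k l : Fin 3), r * |pD k (fun y => uC r (Φ.flow s z) y l) x| ≤ 32 * (D + 2 * E) * (1 / c + 8 * D / c ^ 2) := by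
  intro N σ r τ c η₁ D E Φ z hr hc hReg hcap s hs x k l
  exact scb_mul_abs_pD_uC_le hr hc (fun y => hReg.rhoC_ge hs y) (fun y => (hcap s hs y).1)
    (fun y => (hcap s hs y).2) x k l

/-- Registered sub-goal `thermalStrainBound_of_coarseBounds`: along a flow, on `Regular σ r τ c η₁ Φ z` and under the
caps `ρ_{2r} ≤ D`, `e_{2r} ≤ E` on `[0,τ] × 𝕋³`, the resolved temperature gradient satisfies
`r |∂ₖ θ_r| ≤ K'(c, D, E)` on `[0,τ] × 𝕋³` (deterministic, every `r > 0`). -/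
theorem thermalStrainBound_of_coarseBounds :
  ∀ {N : ℕ} {σ r τ c η₁ D E : ℝ} {Φ : Flow σ N} {z : Phase N}, 0 < r → 0 < c → Regular σ r τ c η₁ Φ z → (∀ s ∈ Set.Icc (0 : ℝ) τ, ∀ x : T3, rhoC (2 * r) (Φ.flow s z) x ≤ D ∧ kinC (2 * r) (Φ.flow s z) x ≤ E) → ∀ s ∈ Set.Icc (0 : ℝ) τ, ∀ (x : T3) (k : Fin 3), r * |pD k (fun y => thetaC r (Φ.flow s z) y) x| ≤ 2 / 3 * (64 * E / c + 8 * E * (64 * D) / c ^ 2 + 32 * (D + 2 * E) * (1 / c + 8 * D / c ^ 2) * ((4 * D + 8 * E) / c)) := by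
  intro N σ r τ c η₁ D E Φ z hr hc hReg hcap s hs x k
  exact scb_mul_abs_pD_thetaC_le hr hc (fun y => hReg.rhoC_ge hs y) (fun y => (hcap s hs y).1)
    (fun y => (hcap s hs y).2) x k

end Summit.AtomisticToContinuum.HydrodynamicLimit.Theorems.LocalSecondLawLedger

end
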